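import Summits.PneNP.PneNP.Theorems.NegLimitedAmplifiedWindowAmpSums
import Mathlib
import HarnessLib

/-!
# Amplified critical window — stub A, part A4: the hybrid step with a MONOTONE combiner
(cell pnp-ideate, rung F-N1/p3, ROUND-12; line `amplified-window` on item stmt-PneNP-19860, stub A
`MonotoneAmplification`; blueprint HOME/pnp-ideate-p3/r12/BLUEPRINT-A.md §6)

O'Donnell's hybrid argument, monotone version (the heart of stub A): if on every hard block `w ∈ S` and
for every setting of the other blocks the one-block test `a ↦ g (update X w a)` agrees with `f` on at
most `(½ + η)` of the `μ_w`-mass, then replacing the `f`-bits of all hard blocks by independent fair coins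
lowers the agreement with a MONOTONE combiner `Φ` by at most `η·|S|·∏_w mass(μ_w)`:

  `hybridStep`: `agreeAt (bw μ) (Φ ∘ bits) g ≤ hybAgree μ f Φ g S + η·|S|·∏_w Σ_a μ_w a`  (for `0 ≤ η`).

One step (`hybAgree_insert_le`): conditioned on the other blocks and coins, `Φ` as a function of the
replaced bit is monotone of one variable, i.e. `0`, `1` or `id` — never `¬` (`core_le`); constants contribute
`0`, `id` contributes `Σ_a μ_w a·[test = f] − ½·mass ≤ η·mass`.  The sum over block inputs is split at `w`
with `Equiv.funSplitAt`, the coin at `w` is symmetrised with the flip involution.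

STATEMENT NOTE: p3's typed Prop `Amp.HybridStep` (AmpDefs, p479928) omits the hypothesis `0 ≤ η` and is
FALSE as typed (take `Φ` constant: then `agreeAt = hybAgree` and the claim reads `0 ≤ η·|S|·Π`; e.g.
`W = Unit`, `𝒳 = Bool`, `μ tt = 0.3`, `μ ff = 0.7`, `f = id`, `g = Φ = const tt`, `S = {()}`, `η = −0.2`
satisfies every hypothesis).  This file proves the corrected statement `hybridStep` (explicit binders,
`0 ≤ η`), which is what the assembly (BLUEPRINT-A §9, `η = 2γ > 0`) uses.

References: R. O'Donnell, *Hardness amplification within NP*, JCSS 69 (2004), §3 (hybrid argument);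
A. Healy, S. Vadhan, E. Viola, SICOMP 35 (2006), §3 [HealyVadhanViola2006].

HONEST FRAMING: a sub-lemma of the OPEN stub A; nothing here bears on P vs NP.
-/

set_option linter.dupNamespace false -- `Summit.PneNP.PneNP.…`: summit = sub-problem name (D-0017 single-conjunct layout)

namespace Summit.PneNP.PneNP.Theorems.NegLimitedAmplifiedWindow.Amp

open Finset Function
open Summit.PneNP.PneNP.Theorems.NegLimitedDoor (massAt agreeAt)

variable {W 𝒳 : Type}

/-- The hybrid configuration of block bits: coins on `T`, `f`-bits off `T`. -/
def mixCfg [DecidableEq W] (f : 𝒳 → Bool) (T : Finset W) (X : W → 𝒳) (z : W → Bool) : W → Bool :=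
  fun w => if w ∈ T then z w else f (X w)

/-- The agreement indicator as a real number. -/
noncomputable def ind (g : (W → 𝒳) → Bool) (Φ : (W → Bool) → Bool) (X : W → 𝒳) (c : W → Bool) : ℝ :=
  if g X = Φ c then 1 else 0

/-- `hybAgree` in terms of `mixCfg` / `ind` (definitional). -/
theorem hybAgree_eq [Fintype W] [DecidableEq W] [Fintype 𝒳] (μ : W → 𝒳 → ℝ) (f : 𝒳 → Bool)
    (Φ : (W → Bool) → Bool) (g : (W → 𝒳) → Bool) (T : Finset W) :
    hybAgree μ f Φ g T = ∑ X : W → 𝒳, bw μ X * (((2 : ℝ) ^ Fintype.card W)⁻¹ *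
      ∑ z : W → Bool, ind g Φ X (mixCfg f T X z)) := rfl

/-- At `T = ∅` the hybrid agreement is the plain agreement. -/
theorem hybAgree_empty [Fintype W] [DecidableEq W] [Fintype 𝒳] (μ : W → 𝒳 → ℝ) (f : 𝒳 → Bool) (Φ : (W → Bool) → Bool) (g : (W → 𝒳) → Bool) :
    hybAgree μ f Φ g ∅ = agreeAt (bw μ) (fun X => Φ fun w => f (X w)) g := by
  rw [hybAgree_eq]
  unfold agreeAt
  refine Finset.sum_congr rfl fun X _ => ?_
  have hcfg : ∀ z : W → Bool, mixCfg f ∅ X z = fun w => f (X w) := fun z => by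
    funext w; simp [mixCfg]
  simp only [hcfg, Finset.sum_const, Finset.card_univ, Fintype.card_fun, Fintype.card_bool, nsmul_eq_mul,
    Nat.cast_pow, Nat.cast_ofNat]
  have h2 : ((2 : ℝ) ^ Fintype.card W) ≠ 0 := by positivity
  rw [ind]
  split_ifs
  · field_simp
  · simp

/-! #### Gluing a block value into an environment -/

/-- Glue the value `a` at block `w` into the environment `X'` of the other blocks. -/
def glue [DecidableEq W] (w : W) (a : 𝒳) (X' : {u // u ≠ w} → 𝒳) : W → 𝒳 := (Equiv.funSplitAt w 𝒳).symm (a, X')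

/-- Updating the glued block replaces the glued value. -/
theorem update_glue [DecidableEq W] (w : W) (a b : 𝒳) (X' : {u // u ≠ w} → 𝒳) : update (glue w a X') w b = glue w b X' := by
  funext u
  by_cases h : u = w
  · subst h; simp [glue]
  · simp [h, glue, Equiv.funSplitAt, Equiv.piSplitAt]

/-- Splitting a sum over block inputs at the block `w`. -/
theorem sum_split [Fintype W] [DecidableEq W] [Fintype 𝒳] (w : W) (G : (W → 𝒳) → ℝ) :
    ∑ X : W → 𝒳, G X = ∑ X' : {u // u ≠ w} → 𝒳, ∑ a : 𝒳, G (glue w a X') := by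
  rw [← Fintype.sum_equiv (Equiv.funSplitAt w 𝒳).symm (fun p => G (glue w p.1 p.2)) G (fun p => rfl),
    Fintype.sum_prod_type, Finset.sum_comm]

/-- The block-product weight of an updated input: `μ_w(a)` times the weight of the other blocks. -/
theorem bw_update [Fintype W] [DecidableEq W] [Fintype 𝒳] (μ : W → 𝒳 → ℝ) (X : W → 𝒳) (w : W) (a : 𝒳) :
    bw μ (update X w a) = μ w a * ∏ u ∈ univ.erase w, μ u (X u) := by
  unfold bw
  rw [← Finset.mul_prod_erase univ _ (Finset.mem_univ w), update_self]
  congr 1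
  exact Finset.prod_congr rfl fun u hu => by rw [update_of_ne (Finset.ne_of_mem_erase hu)]

/-! #### The configurations around one block -/

/-- Flip the coin at `w`. -/
def flipAt [DecidableEq W] (w : W) (z : W → Bool) : W → Bool := update z w (!z w)

/-- `flipAt w` is an involution. -/
theorem flipAt_flipAt [DecidableEq W] (w : W) (z : W → Bool) : flipAt w (flipAt w z) = z := by
  funext u
  by_cases h : u = w
  · subst h; simp [flipAt]
  · simp [flipAt, h]

/-- Off `T ∌ w`: the configuration of an updated input is the `T ∪ {w}`-configuration with the bit
`f a` at `w`. -/
theorem mixCfg_update_of_not_mem [DecidableEq W] (f : 𝒳 → Bool) {T : Finset W} {w : W} (hw : w ∉ T) (X : W → 𝒳)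
    (z : W → Bool) (a : 𝒳) :
    mixCfg f T (update X w a) z = update (mixCfg f (insert w T) X z) w (f a) := by
  funext u
  by_cases h : u = w
  · subst h; simp [mixCfg, hw]
  · simp [mixCfg, h]

/-- On `T ∪ {w}`: updating the input at `w` does not change the configuration, whose bit at `w` is
the coin. -/
theorem mixCfg_insert_update [DecidableEq W] (f : 𝒳 → Bool) (T : Finset W) (w : W) (X : W → 𝒳) (z : W → Bool) (a : 𝒳) :
    mixCfg f (insert w T) (update X w a) z = update (mixCfg f (insert w T) X z) w (z w) := by
  funext u
  by_cases h : u = w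
  · subst h; simp [mixCfg]
  · simp [mixCfg, h]

/-- The flipped coin at `w`. -/
theorem flipAt_apply_self [DecidableEq W] (w : W) (z : W → Bool) : flipAt w z w = !z w := by
  simp [flipAt]

/-- Flipping the coin at `w` does not change the configuration off `w`. -/
theorem update_mixCfg_flipAt [DecidableEq W] (f : 𝒳 → Bool) (T : Finset W) (w : W) (X : W → 𝒳)
    (z : W → Bool) (b : Bool) :
    update (mixCfg f T X (flipAt w z)) w b = update (mixCfg f T X z) w b := by
  funext u
  by_cases h : u = w
  · subst h; simp
  · simp [mixCfg, h, flipAt]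

/-! #### The core one-block inequality -/

/-- **Core**: conditioned on everything but block `w`, a monotone `Φ` is `0`, `1` or `id` in the bit at
`w`, so the symmetrised one-step loss is at most `η·mass(μ_w)` under the one-sided agreement bound. -/
theorem core_le [DecidableEq W] [Fintype 𝒳] (μ : W → 𝒳 → ℝ) (f : 𝒳 → Bool) {Φ : (W → Bool) → Bool} (hΦ : Monotone Φ)
    (g : (W → 𝒳) → Bool) (w : W) (X : W → 𝒳) (κ : W → Bool) {η : ℝ} (hη : 0 ≤ η)
    (hμ : ∀ a, 0 ≤ μ w a)
    (hyp : (∑ a, if g (update X w a) = f a then μ w a else 0) ≤ (1 / 2 + η) * ∑ a, μ w a) :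
    ∑ a, μ w a * (ind g Φ (update X w a) (update κ w (f a)) -
      (ind g Φ (update X w a) (update κ w true) + ind g Φ (update X w a) (update κ w false)) / 2) ≤
      η * ∑ a, μ w a := by
  have hM : 0 ≤ ∑ a, μ w a := Finset.sum_nonneg fun a _ => hμ a
  have hmono : Φ (update κ w false) ≤ Φ (update κ w true) :=
    hΦ (update_le_update_iff.2 ⟨Bool.false_le _, fun _ _ => le_rfl⟩)
  by_cases hc : Φ (update κ w false) = Φ (update κ w true)
  · -- constant in the bit: every summand vanishes
    have h0 : ∀ a, ind g Φ (update X w a) (update κ w (f a)) -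
        (ind g Φ (update X w a) (update κ w true) + ind g Φ (update X w a) (update κ w false)) / 2 = 0 := by
      intro a
      unfold ind
      cases f a <;> simp [hc]
    simp only [h0, mul_zero, Finset.sum_const_zero]
    exact mul_nonneg hη hM
  · -- the identity in the bit: `Φ (update κ w b) = b`
    have hft : Φ (update κ w false) = false ∧ Φ (update κ w true) = true := by
      revert hmono hc
      cases Φ (update κ w false) <;> cases Φ (update κ w true) <;> simp
    have h1 : ∀ a, ind g Φ (update X w a) (update κ w (f a)) -
        (ind g Φ (update X w a) (update κ w true) + ind g Φ (update X w a) (update κ w false)) / 2 =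
        (if g (update X w a) = f a then (1 : ℝ) else 0) - 1 / 2 := by
      intro a
      unfold ind
      have hfa : Φ (update κ w (f a)) = f a := by cases f a <;> simp [hft.1, hft.2]
      rw [hfa, hft.1, hft.2]
      cases g (update X w a) <;> simp
    simp only [h1, mul_sub, Finset.sum_sub_distrib]
    have h2 : ∑ a, μ w a * (if g (update X w a) = f a then (1 : ℝ) else 0) =
        ∑ a, if g (update X w a) = f a then μ w a else 0 :=
      Finset.sum_congr rfl fun a _ => by split_ifs <;> simp
    rw [h2, ← Finset.sum_mul]
    linarith

/-! #### One hybrid step -/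

/-- **One hybrid step**: replacing the `f`-bit of one more hard block by a fair coin costs at most
`η·∏_w mass(μ_w)`. -/
theorem hybAgree_insert_le [Fintype W] [DecidableEq W] [Fintype 𝒳] (μ : W → 𝒳 → ℝ) (f : 𝒳 → Bool) {Φ : (W → Bool) → Bool} (hΦ : Monotone Φ)
    (g : (W → 𝒳) → Bool) {T : Finset W} {w : W} (hw : w ∉ T) {η : ℝ} (hη : 0 ≤ η)
    (hμ : ∀ u a, 0 ≤ μ u a)
    (hyp : ∀ X : W → 𝒳, (∑ a, if g (update X w a) = f a then μ w a else 0) ≤ (1 / 2 + η) * ∑ a, μ w a) :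
    hybAgree μ f Φ g T ≤ hybAgree μ f Φ g (insert w T) + η * ∏ u, ∑ a, μ u a := by
  classical
  set N := Fintype.card W
  have h2N : (0 : ℝ) < (2 : ℝ) ^ N := by positivity
  -- the symmetrised one-step loss, pointwise in `(X, z)`
  set J : (W → 𝒳) → (W → Bool) → ℝ := fun X z =>
    ind g Φ X (mixCfg f T X z) - (ind g Φ X (mixCfg f (insert w T) X z) +
      ind g Φ X (mixCfg f (insert w T) X (flipAt w z))) / 2 with hJ
  -- (1) the difference of the two hybrids is the weighted sum of `J`
  have hflip : ∀ X : W → 𝒳, ∑ z : W → Bool, ind g Φ X (mixCfg f (insert w T) X (flipAt w z)) =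
      ∑ z : W → Bool, ind g Φ X (mixCfg f (insert w T) X z) := fun X =>
    Equiv.sum_comp (Function.Involutive.toPerm (flipAt w) (flipAt_flipAt w))
      (fun z => ind g Φ X (mixCfg f (insert w T) X z))
  have hdiff1 : hybAgree μ f Φ g T - hybAgree μ f Φ g (insert w T) =
      ∑ X : W → 𝒳, ((2 : ℝ) ^ N)⁻¹ * (bw μ X * ∑ z : W → Bool, J X z) := by
    rw [hybAgree_eq, hybAgree_eq, ← Finset.sum_sub_distrib]
    refine Finset.sum_congr rfl fun X _ => ?_
    have hJsum : ∑ z : W → Bool, J X z = ∑ z, ind g Φ X (mixCfg f T X z) -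
        ∑ z, ind g Φ X (mixCfg f (insert w T) X z) := by
      simp only [hJ, Finset.sum_sub_distrib]
      rw [← Finset.sum_div, Finset.sum_add_distrib, hflip]
      ring
    rw [hJsum]
    ring
  have hdiff : hybAgree μ f Φ g T - hybAgree μ f Φ g (insert w T) =
      ((2 : ℝ) ^ N)⁻¹ * ∑ z : W → Bool, ∑ X : W → 𝒳, bw μ X * J X z := by
    rw [hdiff1, Finset.sum_comm, Finset.mul_sum]
    refine Finset.sum_congr rfl fun X _ => ?_
    simp only [Finset.mul_sum]
  -- (2) for each coin vector, the `X`-sum of `bw·J` is at most `η·Σ_X bw`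
  have hz : ∀ z : W → Bool, ∑ X : W → 𝒳, bw μ X * J X z ≤ η * ∑ X : W → 𝒳, bw μ X := by
    intro z
    rw [Finset.mul_sum, sum_split w (fun X => bw μ X * J X z), sum_split w (fun X => η * bw μ X)]
    refine Finset.sum_le_sum fun X' _ => ?_
    rcases isEmpty_or_nonempty 𝒳 with h𝒳 | ⟨⟨a₀⟩⟩
    · simp
    set X₀ := glue w a₀ X' with hX₀
    have hglue : ∀ a, glue w a X' = update X₀ w a := fun a => by rw [hX₀, update_glue]
    simp only [hglue, bw_update]
    set R := ∏ u ∈ univ.erase w, μ u (X₀ u) with hR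
    have hR0 : 0 ≤ R := Finset.prod_nonneg fun u _ => hμ u _
    -- rewrite `J (update X₀ w a) z` through the configuration `κ`
    set κ := mixCfg f (insert w T) X₀ z with hκ
    have hJa : ∀ a, J (update X₀ w a) z = ind g Φ (update X₀ w a) (update κ w (f a)) -
        (ind g Φ (update X₀ w a) (update κ w true) + ind g Φ (update X₀ w a) (update κ w false)) / 2 := by
      intro a
      simp only [hJ, hκ, mixCfg_update_of_not_mem f hw, mixCfg_insert_update, update_mixCfg_flipAt,
        flipAt_apply_self]
      cases z w <;> simp [add_comm]
    simp only [hJa]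
    have hcore := core_le μ f hΦ g w X₀ κ hη (hμ w) (hyp X₀)
    calc ∑ a, μ w a * R * (ind g Φ (update X₀ w a) (update κ w (f a)) -
          (ind g Φ (update X₀ w a) (update κ w true) + ind g Φ (update X₀ w a) (update κ w false)) / 2)
        = R * ∑ a, μ w a * (ind g Φ (update X₀ w a) (update κ w (f a)) -
          (ind g Φ (update X₀ w a) (update κ w true) + ind g Φ (update X₀ w a) (update κ w false)) / 2) := by
          rw [Finset.mul_sum]; exact Finset.sum_congr rfl fun a _ => by ring
      _ ≤ R * (η * ∑ a, μ w a) := mul_le_mul_of_nonneg_left hcore hR0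
      _ = ∑ a, η * (μ w a * R) := by rw [Finset.mul_sum, Finset.mul_sum]; exact Finset.sum_congr rfl fun a _ => by ring
  -- (3) sum over the coins
  have htot : hybAgree μ f Φ g T - hybAgree μ f Φ g (insert w T) ≤ η * ∏ u, ∑ a, μ u a := by
    rw [hdiff, ← sum_bw_eq_prod]
    calc ((2 : ℝ) ^ N)⁻¹ * ∑ z : W → Bool, ∑ X : W → 𝒳, bw μ X * J X z
        ≤ ((2 : ℝ) ^ N)⁻¹ * ∑ _z : W → Bool, η * ∑ X : W → 𝒳, bw μ X :=
          mul_le_mul_of_nonneg_left (Finset.sum_le_sum fun z _ => hz z) (by positivity)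
      _ = η * ∑ X : W → 𝒳, bw μ X := by
          rw [Finset.sum_const, Finset.card_univ, Fintype.card_fun, Fintype.card_bool, nsmul_eq_mul,
            Nat.cast_pow, Nat.cast_ofNat, ← mul_assoc, inv_mul_cancel₀ h2N.ne', one_mul]
  linarith

/-- **A4, corrected (`0 ≤ η`): the hybrid step with a monotone combiner.** -/
theorem hybridStep [Fintype W] [DecidableEq W] [Fintype 𝒳] (μ : W → 𝒳 → ℝ) (f : 𝒳 → Bool) {Φ : (W → Bool) → Bool} (hΦ : Monotone Φ)
    (g : (W → 𝒳) → Bool) (S : Finset W) {η : ℝ} (hη : 0 ≤ η) (hμ : ∀ w a, 0 ≤ μ w a)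
    (hyp : ∀ w ∈ S, ∀ X : W → 𝒳,
      (∑ a, if g (update X w a) = f a then μ w a else 0) ≤ (1 / 2 + η) * ∑ a, μ w a) :
    agreeAt (bw μ) (fun X => Φ fun w => f (X w)) g ≤
      hybAgree μ f Φ g S + η * S.card * ∏ w, ∑ a, μ w a := by
  classical
  rw [← hybAgree_empty]
  induction S using Finset.induction_on with
  | empty => simp
  | @insert w T hw ih =>
    have ih' := ih fun u hu X => hyp u (Finset.mem_insert_of_mem hu) X
    have hstep := hybAgree_insert_le μ f hΦ g hw hη hμ fun X => hyp w (Finset.mem_insert_self w T) X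
    rw [Finset.card_insert_of_notMem hw]
    push_cast
    nlinarith [hstep, ih', Finset.prod_nonneg fun u (_ : u ∈ (univ : Finset W)) =>
      Finset.sum_nonneg fun a (_ : a ∈ (univ : Finset 𝒳)) => hμ u a]

end Summit.PneNP.PneNP.Theorems.NegLimitedAmplifiedWindow.Amp
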